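/-
Copyright (c) 2026 the pub-hodgecm-mathlib formalisation cell (harness21).  Prover seat hodgecm-mathlib-F0P2-p10 (g3), Track B «K2-LIT»,
#184♮ = hLiu418 = `stmt-HodgeConjecture-24832`; socket #41, KIND 1, line (K1b-W) — brick (ρ8) of K1b∕ρ DESK WORD #5 (K2Liu-p14 (g4), 2026-09-04T23:45:45Z),
dealt by LEAD F0P6-plan (g14) BATCH #165 (4) ∕ #171 (2).  THEOREMS ONLY (no `def`, no `instance`, no notation, no named-fact hypothesis, no `sorry`).
-/
import Summits.HodgeConjecture.HodgeConjecture.Theorems.K2LiuConstantTermBigCellUnfold   -- ★ `apply_out_mk_mul`; ★ `K2LiuSiegelEisensteinDoubledLeftInvariant.exists_equiv_siegelDeltaQuot_mulRight`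
import HarnessLib

/-!
# Crux `HLiu418`, socket #41, KIND 1, line (K1b-W) — (ρ8) `K2LiuConstantTermRestTranslate`:
# THE `REST`-CELL SUM IS LEFT-`N_Δ(L⁺)`-INVARIANT — right multiplication by `γ ∈ N_Δ(L⁺)` permutes `REST ⊆ P_Δ(L⁺)\H(L⁺)`

Cell `hodgecm-mathlib`, crux item hLiu418 = `stmt-HodgeConjecture-24832` (helper lane `--supports … --as helper`, count-neutral), route of record `HCCMUnconditional`;
squad K2 ∕ K2Liu, road `K2_Liu`, socket #41 `sig_K2LiuSiegelEisensteinContinuation`, KIND 1, block K1-b♮ (★ ED. 1 `K2LiuKindOneLineTermPackage`), the (supp½) letter.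

WHY.  The (P-supp) assembly `K2LiuKindOneLineSupportIntrinsic.hsupp_middle_of_letters` (K2Liu-p14 (g4)) takes BY VALUE the letter `hrestL`: the `REST`-cell function
`Φ_s(x) = Σ'_{q ∈ REST} f_s(γ_q · x)` — the sum over the cosets `q ∈ P_Δ(L⁺)\H(L⁺)` OTHER than the identity coset `[1]` and the big-cell orbit `{[w_Δ ν] : ν ∈ N_Δ(L⁺)}`, each read at
the chosen representative `γ_q = Quotient.out q` — satisfies `Φ_s(γ · x) = Φ_s(x)` for every rational unipotent `γ ∈ N_Δ(L⁺)`.  THIS FILE pays it, by pure algebra and `tsum` re-indexing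
(no convergence needed): right multiplication by `γ` is a bijection `σ_γ` of `P_Δ(L⁺)\H(L⁺)`, `σ_γ[a] = [aγ]` (★ `exists_equiv_siegelDeltaQuot_mulRight`); it fixes the identity coset
(`[γ] = [1]` as `γ ∈ N_Δ(L⁺) ≤ P_Δ(L⁺)`, ★ `isSiegelDelta_of_mem_unipDelta`) and maps the big-cell orbit into itself (`[w_Δ ν]·γ = [w_Δ (νγ)]`), and so does `σ_{γ⁻¹} = σ_γ⁻¹`; hence
`σ_γ` restricts to a bijection of `REST`, `Equiv.tsum_eq` re-indexes, and the summand is representative-independent (★ `apply_out_mk_mul`: `f(γ_{[aγ]} x) = f(aγ x)`).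
* §1 `mk_coe_eq_mk_one` (`[γ] = [1]`), `wq_mul_eq` (`w_Δν · γ = w_Δ(νγ)` in `H(L⁺)`), **`mem_nonRest_of_mulRight`** (the non-`REST` set `{[1]} ∪ {[w_Δ ν]}` is stable under `σ_γ`),
  `mulRight_inv_comp` (`σ_{γ⁻¹} ∘ σ_γ = id`), **`mem_rest_iff_mulRight_mem_rest`** (`q ∈ REST ↔ σ_γ q ∈ REST`);
* §2 **`tsum_rest_unipDeltaRat_mul`** — THE LETTER `hrestL` (p14 WORD #5 (3) bytes, the `REST` set VERBATIM as in ★ `continuous_tsum_rest` ∕ ★ ED. 1):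
  `Σ'_{q ∈ REST} f(γ_q · (γ · x)) = Σ'_{q ∈ REST} f(γ_q · x)` for a Siegel section `f ∈ I_Δ(s, χ)`, `γ ∈ N_Δ(L⁺)`, `x ∈ H(𝔸)`; and the family form `tsum_rest_unipDeltaRat_mul_family`
  (`∀ s γ x`, the (P-supp) §3 binder with `f s`).
[MoeglinWaldspurger1995, II.1.7 (constant terms along `P_Δ`, the Bruhat cells)] [Garrett2018, §3.10] [Tan1999, §1] [KudlaRallis1994, §2].
HONEST LABEL.  Count-neutral helper, closes no socket by itself: `HC_CM` is proved only modulo the 7 printed citations (2 remaining named inputs: hLiu418 =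
`stmt-HodgeConjecture-24832`, h413 = `stmt-HodgeConjecture-24833`) until rung 0 closes.  NOT HERE: the consumer (P-supp) (K2Liu-p14), (ρ7) the uniform level (K2E3-p03),
(P-supp-lat) (LH4-p18).

## References
* [MoeglinWaldspurger1995] C. Mœglin, J.-L. Waldspurger, *Spectral decomposition and Eisenstein series* (1995): II.1.7.
* [Garrett2018] P. Garrett, *Modern Analysis of Automorphic Forms by Example* (2018): §3.10.   * [Tan1999] V. Tan, Canad. J. Math. 51 (1999): §1.
* [KudlaRallis1994] S. Kudla, S. Rallis, Ann. of Math. 140 (1994): §2.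
-/

set_option autoImplicit false
-- the mandated namespace repeats the single-problem summit's segment (`HodgeConjecture.HodgeConjecture`)
set_option linter.dupNamespace false

noncomputable section

open scoped Matrix
open NumberField IsDedekindDomain Set Function
open Literature.NumberTheory.Automorphic Literature.NumberTheory.GaloisRepresentations
open Literature.NumberTheory.GelbartRogawski1991 Literature.NumberTheory.GelbartRogawski1991.GRConstruction
open Literature.NumberTheory.K2Lit.SiegelDoubled

namespace Summit.HodgeConjecture.HodgeConjecture.Cruxes.HLiu418.K2LiuConstantTermRestTranslate

open K2LiuConstantTermBigCellUnfold (apply_out_mk_mul)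
open K2LiuSiegelEisensteinDoubledLeftInvariant (exists_equiv_siegelDeltaQuot_mulRight)

variable {L : Type} [Field L] [NumberField L] [IsCMField L]
variable {N M n : ℕ} {e : Fin N × Fin M ≃ Fin n}
  {dV : Fin N → L} {hdV : ∀ i, IsCMField.complexConj L (dV i) = dV i}
  {dW : Fin M → L} {hdW : ∀ i, IsCMField.complexConj L (dW i) = dW i}

/-! ## §1 Right multiplication by `γ ∈ N_Δ(L⁺)` permutes `REST` -/

/-- **`[γ] = [1]` in `P_Δ(L⁺)\H(L⁺)` for `γ ∈ H(L⁺)` unipotent** (`N_Δ ≤ P_Δ`, ★ `isSiegelDelta_of_mem_unipDelta`). [cite: MoeglinWaldspurger1995, II.1.7] -/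
theorem mk_coe_eq_mk_one (g : ratH L e dV hdV dW hdW) (hg : (g : HA L e dV hdV dW hdW) ∈ unipDelta L e dV hdV dW hdW) :
    (Quotient.mk (MulAction.orbitRel (siegelDeltaRat L e dV hdV dW hdW) (ratH L e dV hdV dW hdW)) g : SiegelDeltaQuot L e dV hdV dW hdW) =
      Quotient.mk (MulAction.orbitRel (siegelDeltaRat L e dV hdV dW hdW) (ratH L e dV hdV dW hdW)) 1 := by
  have hgP : g ∈ siegelDeltaRat L e dV hdV dW hdW :=
    Subgroup.mem_subgroupOf.2 ((mem_siegelDelta_iff L e dV hdV dW hdW _).2 (isSiegelDelta_of_mem_unipDelta L e dV hdV dW hdW hg))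
  refine Quotient.sound (MulAction.orbitRel_apply.2 (MulAction.mem_orbit_iff.2 ⟨⟨g, hgP⟩, ?_⟩))
  rw [Subgroup.smul_def, smul_eq_mul, mul_one]

/-- **`w_Δ ν · γ = w_Δ (ν γ)` in `H(L⁺)`** for the orbit map `wq` of record (`hwq : wq ν = w_Δ ν`) and `γ ∈ N_Δ(L⁺)` presented as `g ∈ H(L⁺)` with `g ∈ N_Δ(𝔸)`.
[cite: MoeglinWaldspurger1995, II.1.7] -/
theorem wq_mul_eq (wq : unipDeltaRat L e dV hdV dW hdW → ratH L e dV hdV dW hdW)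
    (hwq : ∀ ν, ((wq ν : ratH L e dV hdV dW hdW) : HA L e dV hdV dW hdW) = weylDelta L e dV hdV dW hdW * ((ν : unipDelta L e dV hdV dW hdW) : HA L e dV hdV dW hdW))
    (g : ratH L e dV hdV dW hdW) (hg : (g : HA L e dV hdV dW hdW) ∈ unipDelta L e dV hdV dW hdW) (ν : unipDeltaRat L e dV hdV dW hdW) :
    wq ν * g = wq (ν * ⟨⟨(g : HA L e dV hdV dW hdW), hg⟩, (mem_unipDeltaRat_iff L e dV hdV dW hdW _).2 g.2⟩) := by
  apply Subtype.ext
  rw [Subgroup.coe_mul, hwq, hwq, Subgroup.coe_mul, Subgroup.coe_mul, mul_assoc]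

/-- **THE NON-`REST` SET `{[1]} ∪ {[w_Δ ν]}` IS STABLE UNDER RIGHT MULTIPLICATION BY `γ ∈ N_Δ(L⁺)`**: for a bijection `σ` of `P_Δ(L⁺)\H(L⁺)` with `σ[a] = [a g]`, `g ∈ H(L⁺) ∩ N_Δ(𝔸)`,
`σ[1] = [g] = [1]` and `σ[w_Δ ν] = [w_Δ (ν g)]`. [cite: MoeglinWaldspurger1995, II.1.7] [cite: Garrett2018, §3.10] -/
theorem mem_nonRest_of_mulRight (wq : unipDeltaRat L e dV hdV dW hdW → ratH L e dV hdV dW hdW)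
    (hwq : ∀ ν, ((wq ν : ratH L e dV hdV dW hdW) : HA L e dV hdV dW hdW) = weylDelta L e dV hdV dW hdW * ((ν : unipDelta L e dV hdV dW hdW) : HA L e dV hdV dW hdW))
    (g : ratH L e dV hdV dW hdW) (hg : (g : HA L e dV hdV dW hdW) ∈ unipDelta L e dV hdV dW hdW)
    (σ : SiegelDeltaQuot L e dV hdV dW hdW ≃ SiegelDeltaQuot L e dV hdV dW hdW)
    (hσ : ∀ a : ratH L e dV hdV dW hdW,
      σ (Quotient.mk _ a) = Quotient.mk (MulAction.orbitRel (siegelDeltaRat L e dV hdV dW hdW) (ratH L e dV hdV dW hdW)) (a * g))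
    {q : SiegelDeltaQuot L e dV hdV dW hdW}
    (hq : q ∈ ({Quotient.mk (MulAction.orbitRel (siegelDeltaRat L e dV hdV dW hdW) (ratH L e dV hdV dW hdW)) 1} ∪
            Set.range (fun ν : unipDeltaRat L e dV hdV dW hdW =>
              (Quotient.mk (MulAction.orbitRel (siegelDeltaRat L e dV hdV dW hdW) (ratH L e dV hdV dW hdW)) (wq ν) :
                SiegelDeltaQuot L e dV hdV dW hdW)) : Set (SiegelDeltaQuot L e dV hdV dW hdW))) :
    σ q ∈ ({Quotient.mk (MulAction.orbitRel (siegelDeltaRat L e dV hdV dW hdW) (ratH L e dV hdV dW hdW)) 1} ∪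
            Set.range (fun ν : unipDeltaRat L e dV hdV dW hdW =>
              (Quotient.mk (MulAction.orbitRel (siegelDeltaRat L e dV hdV dW hdW) (ratH L e dV hdV dW hdW)) (wq ν) :
                SiegelDeltaQuot L e dV hdV dW hdW)) : Set (SiegelDeltaQuot L e dV hdV dW hdW)) := by
  rcases hq with hq | ⟨ν, rfl⟩
  · -- `q = [1]` (membership in a singleton is an equation, by `Iff.rfl`)
    have hq' : q = Quotient.mk (MulAction.orbitRel (siegelDeltaRat L e dV hdV dW hdW) (ratH L e dV hdV dW hdW)) 1 := hq
    subst hq'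
    refine Or.inl ?_
    show σ (Quotient.mk _ 1) = Quotient.mk (MulAction.orbitRel (siegelDeltaRat L e dV hdV dW hdW) (ratH L e dV hdV dW hdW)) 1
    rw [hσ, one_mul]
    exact mk_coe_eq_mk_one g hg
  · refine Or.inr ⟨ν * ⟨⟨(g : HA L e dV hdV dW hdW), hg⟩, (mem_unipDeltaRat_iff L e dV hdV dW hdW _).2 g.2⟩, ?_⟩
    show (Quotient.mk (MulAction.orbitRel (siegelDeltaRat L e dV hdV dW hdW) (ratH L e dV hdV dW hdW))
        (wq (ν * ⟨⟨(g : HA L e dV hdV dW hdW), hg⟩, (mem_unipDeltaRat_iff L e dV hdV dW hdW _).2 g.2⟩)) : SiegelDeltaQuot L e dV hdV dW hdW) =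
      σ (Quotient.mk _ (wq ν))
    rw [hσ, wq_mul_eq wq hwq g hg ν]

/-- **`σ_{g⁻¹} ∘ σ_g = id`** on `P_Δ(L⁺)\H(L⁺)` (`[a g g⁻¹] = [a]`). [folklore] -/
theorem mulRight_inv_comp (g : ratH L e dV hdV dW hdW)
    (σ τ : SiegelDeltaQuot L e dV hdV dW hdW ≃ SiegelDeltaQuot L e dV hdV dW hdW)
    (hσ : ∀ a : ratH L e dV hdV dW hdW,
      σ (Quotient.mk _ a) = Quotient.mk (MulAction.orbitRel (siegelDeltaRat L e dV hdV dW hdW) (ratH L e dV hdV dW hdW)) (a * g))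
    (hτ : ∀ a : ratH L e dV hdV dW hdW,
      τ (Quotient.mk _ a) = Quotient.mk (MulAction.orbitRel (siegelDeltaRat L e dV hdV dW hdW) (ratH L e dV hdV dW hdW)) (a * g⁻¹))
    (q : SiegelDeltaQuot L e dV hdV dW hdW) : τ (σ q) = q := by
  have h1 : σ q = Quotient.mk (MulAction.orbitRel (siegelDeltaRat L e dV hdV dW hdW) (ratH L e dV hdV dW hdW)) (Quotient.out q * g) := by
    conv_lhs => rw [← Quotient.out_eq q]
    exact hσ _
  rw [h1, hτ, mul_inv_cancel_right, Quotient.out_eq]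

/-- **`q ∈ REST ↔ σ_γ q ∈ REST`**: the non-`REST` set is stable under `σ_γ` and under `σ_{γ⁻¹} = σ_γ⁻¹` (`γ⁻¹ ∈ N_Δ(L⁺)` too), so `REST` is permuted by `σ_γ`.
[cite: MoeglinWaldspurger1995, II.1.7] [cite: Garrett2018, §3.10] -/
theorem mem_rest_iff_mulRight_mem_rest (wq : unipDeltaRat L e dV hdV dW hdW → ratH L e dV hdV dW hdW)
    (hwq : ∀ ν, ((wq ν : ratH L e dV hdV dW hdW) : HA L e dV hdV dW hdW) = weylDelta L e dV hdV dW hdW * ((ν : unipDelta L e dV hdV dW hdW) : HA L e dV hdV dW hdW))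
    (g : ratH L e dV hdV dW hdW) (hg : (g : HA L e dV hdV dW hdW) ∈ unipDelta L e dV hdV dW hdW)
    (σ τ : SiegelDeltaQuot L e dV hdV dW hdW ≃ SiegelDeltaQuot L e dV hdV dW hdW)
    (hσ : ∀ a : ratH L e dV hdV dW hdW,
      σ (Quotient.mk _ a) = Quotient.mk (MulAction.orbitRel (siegelDeltaRat L e dV hdV dW hdW) (ratH L e dV hdV dW hdW)) (a * g))
    (hτ : ∀ a : ratH L e dV hdV dW hdW,
      τ (Quotient.mk _ a) = Quotient.mk (MulAction.orbitRel (siegelDeltaRat L e dV hdV dW hdW) (ratH L e dV hdV dW hdW)) (a * g⁻¹))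
    (q : SiegelDeltaQuot L e dV hdV dW hdW) :
    q ∈ (({Quotient.mk (MulAction.orbitRel (siegelDeltaRat L e dV hdV dW hdW) (ratH L e dV hdV dW hdW)) 1} ∪
            Set.range (fun ν : unipDeltaRat L e dV hdV dW hdW =>
              (Quotient.mk (MulAction.orbitRel (siegelDeltaRat L e dV hdV dW hdW) (ratH L e dV hdV dW hdW)) (wq ν) :
                SiegelDeltaQuot L e dV hdV dW hdW)))ᶜ : Set (SiegelDeltaQuot L e dV hdV dW hdW)) ↔
      σ q ∈ (({Quotient.mk (MulAction.orbitRel (siegelDeltaRat L e dV hdV dW hdW) (ratH L e dV hdV dW hdW)) 1} ∪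
            Set.range (fun ν : unipDeltaRat L e dV hdV dW hdW =>
              (Quotient.mk (MulAction.orbitRel (siegelDeltaRat L e dV hdV dW hdW) (ratH L e dV hdV dW hdW)) (wq ν) :
                SiegelDeltaQuot L e dV hdV dW hdW)))ᶜ : Set (SiegelDeltaQuot L e dV hdV dW hdW)) := by
  have hg' : ((g⁻¹ : ratH L e dV hdV dW hdW) : HA L e dV hdV dW hdW) ∈ unipDelta L e dV hdV dW hdW := by
    rw [Subgroup.coe_inv]
    exact inv_mem hg
  -- membership in a complement is a negation (`Iff.rfl`); both directions are contrapositives of §1's stability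
  refine ⟨fun hq hσq => hq ?_, fun hσq hq => hσq (mem_nonRest_of_mulRight wq hwq g hg σ hσ hq)⟩
  have h2 := mem_nonRest_of_mulRight wq hwq g⁻¹ hg' τ hτ hσq
  rwa [mulRight_inv_comp g σ τ hσ hτ q] at h2

/-! ## §2 The letter `hrestL`: `Σ'_{q ∈ REST} f(γ_q · γ · x) = Σ'_{q ∈ REST} f(γ_q · x)` -/

/-- **(ρ8) THE `REST`-CELL SUM IS LEFT-`N_Δ(L⁺)`-INVARIANT.**  For a Siegel section `f ∈ I_Δ(s, χ)` (★ `IsSiegelDeltaSection`), the orbit map `wq` of record (`wq ν = w_Δ ν`),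
`γ ∈ N_Δ(L⁺)` and `x ∈ H(𝔸)`:  `Σ'_{q ∈ REST} f(γ_q · (γ · x)) = Σ'_{q ∈ REST} f(γ_q · x)`, `REST = ({[1]} ∪ {[w_Δ ν]})ᶜ ⊆ P_Δ(L⁺)\H(L⁺)`, `γ_q = Quotient.out q` — pure algebra,
whatever the summability: re-index along the bijection `q ↦ [γ_q γ]` of `REST` (§1, Mathlib `Equiv.subtypeEquiv`, `Equiv.tsum_eq`) and use representative independence
`f(γ_{[γ_q γ]} x) = f(γ_q γ x)` (★ `apply_out_mk_mul`). [cite: MoeglinWaldspurger1995, II.1.7] [cite: Garrett2018, §3.10] [cite: Tan1999, §1] -/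
theorem tsum_rest_unipDeltaRat_mul {χ : HeckeCharacter L} {s : ℂ} {f : HA L e dV hdV dW hdW → ℂ} (hf : IsSiegelDeltaSection L e dV hdV dW hdW χ s f)
    (wq : unipDeltaRat L e dV hdV dW hdW → ratH L e dV hdV dW hdW)
    (hwq : ∀ ν, ((wq ν : ratH L e dV hdV dW hdW) : HA L e dV hdV dW hdW) = weylDelta L e dV hdV dW hdW * ((ν : unipDelta L e dV hdV dW hdW) : HA L e dV hdV dW hdW))
    (γ : unipDeltaRat L e dV hdV dW hdW) (x : HA L e dV hdV dW hdW) :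
    (∑' q : ↥(({Quotient.mk (MulAction.orbitRel (siegelDeltaRat L e dV hdV dW hdW) (ratH L e dV hdV dW hdW)) 1} ∪
            Set.range (fun ν : unipDeltaRat L e dV hdV dW hdW =>
              (Quotient.mk (MulAction.orbitRel (siegelDeltaRat L e dV hdV dW hdW) (ratH L e dV hdV dW hdW)) (wq ν) :
                SiegelDeltaQuot L e dV hdV dW hdW)))ᶜ : Set (SiegelDeltaQuot L e dV hdV dW hdW)),
          f ((((Quotient.out (q : SiegelDeltaQuot L e dV hdV dW hdW) : ratH L e dV hdV dW hdW) : HA L e dV hdV dW hdW)) *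
            ((((γ : unipDelta L e dV hdV dW hdW)) : HA L e dV hdV dW hdW) * x))) =
      ∑' q : ↥(({Quotient.mk (MulAction.orbitRel (siegelDeltaRat L e dV hdV dW hdW) (ratH L e dV hdV dW hdW)) 1} ∪
            Set.range (fun ν : unipDeltaRat L e dV hdV dW hdW =>
              (Quotient.mk (MulAction.orbitRel (siegelDeltaRat L e dV hdV dW hdW) (ratH L e dV hdV dW hdW)) (wq ν) :
                SiegelDeltaQuot L e dV hdV dW hdW)))ᶜ : Set (SiegelDeltaQuot L e dV hdV dW hdW)),
          f ((((Quotient.out (q : SiegelDeltaQuot L e dV hdV dW hdW) : ratH L e dV hdV dW hdW) : HA L e dV hdV dW hdW)) * x) := by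
  -- right multiplication by `γ` (as a rational point of `H`) and by `γ⁻¹` on `P_Δ(L⁺)\H(L⁺)`
  have hγH : ((γ : unipDelta L e dV hdV dW hdW) : HA L e dV hdV dW hdW) ∈ ratH L e dV hdV dW hdW := (mem_unipDeltaRat_iff L e dV hdV dW hdW _).1 γ.2
  obtain ⟨σ, hσ⟩ := exists_equiv_siegelDeltaQuot_mulRight L e dV hdV dW hdW ⟨((γ : unipDelta L e dV hdV dW hdW) : HA L e dV hdV dW hdW), hγH⟩
  obtain ⟨τ, hτ⟩ := exists_equiv_siegelDeltaQuot_mulRight L e dV hdV dW hdW ⟨((γ : unipDelta L e dV hdV dW hdW) : HA L e dV hdV dW hdW), hγH⟩⁻¹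
  -- `REST` is permuted (§1), so `σ` restricts to a bijection `ρ` of `↥REST`
  have hiff := mem_rest_iff_mulRight_mem_rest wq hwq ⟨((γ : unipDelta L e dV hdV dW hdW) : HA L e dV hdV dW hdW), hγH⟩
    (γ : unipDelta L e dV hdV dW hdW).2 σ τ hσ hτ
  refine Eq.trans (tsum_congr fun q => ?_) (Equiv.tsum_eq (σ.subtypeEquiv hiff) fun q =>
    f ((((Quotient.out (q : SiegelDeltaQuot L e dV hdV dW hdW) : ratH L e dV hdV dW hdW) : HA L e dV hdV dW hdW)) * x))
  -- termwise: `ρ q = [γ_q γ]` and `f(γ_{[γ_q γ]} x) = f(γ_q γ x)` (★ `apply_out_mk_mul`)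
  have hρq : ((σ.subtypeEquiv hiff q : ↥(({Quotient.mk (MulAction.orbitRel (siegelDeltaRat L e dV hdV dW hdW) (ratH L e dV hdV dW hdW)) 1} ∪
            Set.range (fun ν : unipDeltaRat L e dV hdV dW hdW =>
              (Quotient.mk (MulAction.orbitRel (siegelDeltaRat L e dV hdV dW hdW) (ratH L e dV hdV dW hdW)) (wq ν) :
                SiegelDeltaQuot L e dV hdV dW hdW)))ᶜ : Set (SiegelDeltaQuot L e dV hdV dW hdW))) : SiegelDeltaQuot L e dV hdV dW hdW) =
      Quotient.mk (MulAction.orbitRel (siegelDeltaRat L e dV hdV dW hdW) (ratH L e dV hdV dW hdW))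
        (Quotient.out (q : SiegelDeltaQuot L e dV hdV dW hdW) * ⟨((γ : unipDelta L e dV hdV dW hdW) : HA L e dV hdV dW hdW), hγH⟩) := by
    show σ (q : SiegelDeltaQuot L e dV hdV dW hdW) = _
    conv_lhs => rw [← Quotient.out_eq (q : SiegelDeltaQuot L e dV hdV dW hdW)]
    exact hσ _
  show _ = f ((((Quotient.out ((σ.subtypeEquiv hiff q : ↥(({Quotient.mk (MulAction.orbitRel (siegelDeltaRat L e dV hdV dW hdW) (ratH L e dV hdV dW hdW)) 1} ∪
            Set.range (fun ν : unipDeltaRat L e dV hdV dW hdW =>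
              (Quotient.mk (MulAction.orbitRel (siegelDeltaRat L e dV hdV dW hdW) (ratH L e dV hdV dW hdW)) (wq ν) :
                SiegelDeltaQuot L e dV hdV dW hdW)))ᶜ : Set (SiegelDeltaQuot L e dV hdV dW hdW))) : SiegelDeltaQuot L e dV hdV dW hdW) :
      ratH L e dV hdV dW hdW) : HA L e dV hdV dW hdW)) * x)
  rw [hρq, apply_out_mk_mul hf, Subgroup.coe_mul, mul_assoc]

/-- **(ρ8) FAMILY FORM** — the (P-supp) §3 binder `hrestL` VERBATIM (`∀ s γ x`, section family `f : ℂ → H(𝔸) → ℂ` with every `f s ∈ I_Δ(s, χ)`).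
[cite: MoeglinWaldspurger1995, II.1.7] [cite: Garrett2018, §3.10] [cite: Tan1999, §1] -/
theorem tsum_rest_unipDeltaRat_mul_family {χ : HeckeCharacter L} {f : ℂ → HA L e dV hdV dW hdW → ℂ}
    (hfΔ : ∀ s, IsSiegelDeltaSection L e dV hdV dW hdW χ s (f s))
    (wq : unipDeltaRat L e dV hdV dW hdW → ratH L e dV hdV dW hdW)
    (hwq : ∀ ν, ((wq ν : ratH L e dV hdV dW hdW) : HA L e dV hdV dW hdW) = weylDelta L e dV hdV dW hdW * ((ν : unipDelta L e dV hdV dW hdW) : HA L e dV hdV dW hdW)) :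
    ∀ (s : ℂ) (γ : unipDeltaRat L e dV hdV dW hdW) (x : HA L e dV hdV dW hdW),
      (∑' q : ↥(({Quotient.mk (MulAction.orbitRel (siegelDeltaRat L e dV hdV dW hdW) (ratH L e dV hdV dW hdW)) 1} ∪
            Set.range (fun ν : unipDeltaRat L e dV hdV dW hdW =>
              (Quotient.mk (MulAction.orbitRel (siegelDeltaRat L e dV hdV dW hdW) (ratH L e dV hdV dW hdW)) (wq ν) :
                SiegelDeltaQuot L e dV hdV dW hdW)))ᶜ : Set (SiegelDeltaQuot L e dV hdV dW hdW)),
          f s ((((Quotient.out (q : SiegelDeltaQuot L e dV hdV dW hdW) : ratH L e dV hdV dW hdW) : HA L e dV hdV dW hdW)) *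
            ((((γ : unipDelta L e dV hdV dW hdW)) : HA L e dV hdV dW hdW) * x))) =
        ∑' q : ↥(({Quotient.mk (MulAction.orbitRel (siegelDeltaRat L e dV hdV dW hdW) (ratH L e dV hdV dW hdW)) 1} ∪
            Set.range (fun ν : unipDeltaRat L e dV hdV dW hdW =>
              (Quotient.mk (MulAction.orbitRel (siegelDeltaRat L e dV hdV dW hdW) (ratH L e dV hdV dW hdW)) (wq ν) :
                SiegelDeltaQuot L e dV hdV dW hdW)))ᶜ : Set (SiegelDeltaQuot L e dV hdV dW hdW)),
          f s ((((Quotient.out (q : SiegelDeltaQuot L e dV hdV dW hdW) : ratH L e dV hdV dW hdW) : HA L e dV hdV dW hdW)) * x) :=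
  fun s γ x => tsum_rest_unipDeltaRat_mul (hfΔ s) wq hwq γ x

end Summit.HodgeConjecture.HodgeConjecture.Cruxes.HLiu418.K2LiuConstantTermRestTranslate

end
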